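import Summits.QuantumFields.YangMills.Theorems.PoincareLipschitzSphereMapSmallRangeEnergyDecay
import Summits.QuantumFields.YangMills.Theorems.PoincareLipschitzSphereMapSmallRangeTwistedLetters
import HarnessLib

/-!
# Small-range regularity of one-site-optimal sphere maps, TWISTED — FILE 2-τ: energy decay by FLAT harmonic replacement

SEAT ym3-torus-px7 g5 (helper for `stmt-QuantumFields-19936`, K2 END-GAME lane [D] of LEAD ym-ust-19936-w1 g8's 05:29:02Z ruling «STOP AT HÖLDER»).
The twisted twin of ✓`PoincareLipschitzSphereMapSmallRangeEnergyDecay.smallRange_energy_decay` (✓p698348).  Setting = ✓`PoincareLipschitzCovariantCaccioppoli`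
letters: `V` a real inner-product space, `u : ℤ^d → V` unit-sphere valued, isometric bond transports `τ : Fin d → ℤ^d → (V ≃ₗᵢ[ℝ] V)` with sup defect
`‖τ μ y v − v‖ ≤ τ₀‖v‖`, twisted one-site optimality `‖N(y)‖·u(y) = N(y)`, `N(y) = Σ_μ (τ μ y (u(y+e_μ)) + (τ μ (y−e_μ))⁻¹ (u(y−e_μ)))`.

THE POINT.  The FLAT harmonic replacement `h` of `u` on `Q_r(z)` is kept (so the landed flat maximum principle ✓`norm_sub_le_of_vecHarmonic` and the landed
flat decay ✓`vec_harmonic_decay` are used as they stand — no covariant harmonic decay is needed); only the Euler–Lagrange input changes: by (I1)_τ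
(✓`nbr_sum_sub_eq_twisted`) the FLAT Laplacian reads `−Δu = λ_τ·u + T′`, `T′(y) = Σ_μ ((τ−1)u(y+e_μ) + (τ⁻¹−1)u(y−e_μ))`, `‖T′‖ ≤ 2dτ₀`, `0 ≤ λ_τ ≤ λ + 2dτ₀`,
so the corrector energy is `E(w) ≤ 2ω·E(u;Q_{r+1}) + 8dωτ₀·#Q_r` and the decay inequality acquires the ADDITIVE twist term `(4A+2)·8dωτ₀(2r+1)^d`.

WHAT IS PROVED (ns `…SphereMapSmallRangeEnergyDecayTwisted`): `norm_twistDefectSum_le` (‖T′‖ ≤ 2dτ₀), `lamTw_le` (λ_τ ≤ λ + 2dτ₀), ★★ `smallRange_energy_decay_twisted`: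
`E(u;Q_ρ) ≤ (4A((ρ+1)∕r)^d + (8A+4)·2ω)·E(u;Q_{r+1}) + (4A+2)·(8dωτ₀)·(2r+1)^d`, `E` the FLAT energy, `A = 2^d(1+56d)^d(8(d+1))^{d+1}`.
HONEST SCOPE.  [folklore] ([Giaquinta1984] Ch. VI §1 Thm 1.1 step II pp.128–131; the twist bookkeeping as in [Balaban1985BackgroundPropagators] §3 (3.8)–(3.12)).
A helper; proves nothing of `hImprove`∕`hRegH`∕`stmt-QuantumFields-19936`; YM₃ on T³ is rung R3, not Clay.
-/

set_option autoImplicit false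

noncomputable section

open scoped BigOperators InnerProductSpace
open Finset

namespace Summit.QuantumFields.YangMills.Theorems.PoincareLipschitzSphereMapSmallRangeEnergyDecayTwisted

open Literature.MathematicalPhysics.QuantumFieldTheory.Balaban1983to89
open B4Eq19LatticeOperators
open Summit.QuantumFields.YangMills.Theorems.PoincareLipschitzCovariantDirichlet (energy_le_of_support)
open Summit.QuantumFields.YangMills.Theorems.PoincareLipschitzSphereMapSmallRangeCaccioppoli (one_sub_inner_eq one_sub_inner_nonneg)
open Summit.QuantumFields.YangMills.Theorems.PoincareLipschitzSphereMapSmallRangeEnergyDecay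
  (exists_vec_dirichlet vec_energy_identity norm_sub_le_of_vecHarmonic vec_harmonic_decay)
open Summit.QuantumFields.YangMills.Theorems.PoincareLipschitzSphereMapSmallRangeTwistedLetters (norm_symm_sub_le nbr_sum_sub_eq_twisted)

variable {d : ℕ} {V : Type*} [NormedAddCommGroup V] [InnerProductSpace ℝ V]

/-! ## §1 Twist bookkeeping at one site -/

/-- `‖Σ_μ ((τ μ y a_μ − a_μ) + ((τ μ (y−e_μ))⁻¹ b_μ − b_μ))‖ ≤ 2dτ₀` for unit vectors `a_μ, b_μ` when every transport involved has defect `≤ τ₀`. [folklore] -/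
theorem norm_twistDefectSum_le (τ : Fin d → Zd d → (V ≃ₗᵢ[ℝ] V)) (y : Zd d) (a b : Fin d → V) {τ₀ : ℝ}
    (ha : ∀ μ, ‖a μ‖ = 1) (hb : ∀ μ, ‖b μ‖ = 1)
    (hfw : ∀ μ (v : V), ‖τ μ y v - v‖ ≤ τ₀ * ‖v‖) (hbw : ∀ μ (v : V), ‖τ μ (y - unitVec μ) v - v‖ ≤ τ₀ * ‖v‖) :
    ‖∑ μ, ((τ μ y (a μ) - a μ) + ((τ μ (y - unitVec μ)).symm (b μ) - b μ))‖ ≤ 2 * d * τ₀ := by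
  calc ‖∑ μ, ((τ μ y (a μ) - a μ) + ((τ μ (y - unitVec μ)).symm (b μ) - b μ))‖
      ≤ ∑ μ, ‖(τ μ y (a μ) - a μ) + ((τ μ (y - unitVec μ)).symm (b μ) - b μ)‖ := norm_sum_le _ _
    _ ≤ ∑ _μ : Fin d, (τ₀ + τ₀) := Finset.sum_le_sum fun μ _ => by
        calc ‖(τ μ y (a μ) - a μ) + ((τ μ (y - unitVec μ)).symm (b μ) - b μ)‖
            ≤ ‖τ μ y (a μ) - a μ‖ + ‖(τ μ (y - unitVec μ)).symm (b μ) - b μ‖ := norm_add_le _ _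
          _ ≤ τ₀ * ‖a μ‖ + τ₀ * ‖b μ‖ := add_le_add (hfw μ (a μ)) (norm_symm_sub_le _ (hbw μ) (b μ))
          _ = τ₀ + τ₀ := by rw [ha μ, hb μ, mul_one]
    _ = 2 * d * τ₀ := by rw [Finset.sum_const, Finset.card_univ, Fintype.card_fin, nsmul_eq_mul]; ring

/-- `|⟪u, T a⟫ − ⟪u, a⟫| ≤ τ₀` for unit `u, a` and a transport of defect `≤ τ₀`: the twisted density exceeds the flat one by at most `τ₀` per half-bond. [folklore] -/
theorem oneSubInner_twist_le (T : V ≃ₗᵢ[ℝ] V) {τ₀ : ℝ} (hT : ∀ v, ‖T v - v‖ ≤ τ₀ * ‖v‖) {u a : V} (hu : ‖u‖ = 1) (ha : ‖a‖ = 1) :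
    1 - ⟪u, T a⟫_ℝ ≤ (1 - ⟪u, a⟫_ℝ) + τ₀ := by
  have h1 : ⟪u, a⟫_ℝ - ⟪u, T a⟫_ℝ = ⟪u, a - T a⟫_ℝ := by rw [inner_sub_right]
  have h2 : ⟪u, a - T a⟫_ℝ ≤ τ₀ := by
    calc ⟪u, a - T a⟫_ℝ ≤ ‖u‖ * ‖a - T a‖ := real_inner_le_norm _ _
      _ ≤ 1 * (τ₀ * ‖a‖) := by rw [hu, norm_sub_rev]; exact mul_le_mul_of_nonneg_left (hT a) zero_le_one
      _ = τ₀ := by rw [ha, mul_one, one_mul]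
  linarith

/-! ## §2 The twisted energy decay -/

set_option maxHeartbeats 400000 in
/-- ★★ **SMALL-RANGE ENERGY DECAY, TWISTED** (HKW ∕ Giaquinta–Giusti direct method with a FLAT harmonic replacement): `d ≥ 1`, `0 ≤ ρ`, `ρ + 1 ≤ r`; `u` unit-sphere
valued with `‖u − p‖ ≤ ω` on `Q_{r+2}(z)`, transports of defect `≤ τ₀` on `Q_{r+1}(z)`, twisted one-site optimal on `Q_{r+1}(z)`.  Then, `E` denoting the FLAT energy
`E(u;Q) = Σ_{y∈Q}Σ_μ ‖u(y+e_μ) − u(y)‖²` and `A = 2^d(1+56d)^d(8(d+1))^{d+1}`,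
`E(u;Q_ρ) ≤ (4A((ρ+1)∕r)^d + (8A+4)·2ω)·E(u;Q_{r+1}) + (4A+2)·(8dωτ₀)·(2r+1)^d`.
[folklore] [cite: Giaquinta1984, Ch. VI §1 Thm 1.1 step II pp.128-131; Balaban1985BackgroundPropagators, §3 (3.8)-(3.12) p.392] -/
theorem smallRange_energy_decay_twisted [FiniteDimensional ℝ V] (hd : 1 ≤ d) (τ : Fin d → Zd d → (V ≃ₗᵢ[ℝ] V)) (u : Zd d → V) (p : V) (z : Zd d)
    {ρ r : ℤ} (hρ : 0 ≤ ρ) (hr : 1 ≤ r) (hρr : ρ + 1 ≤ r) {ω τ₀ : ℝ} (hω0 : 0 ≤ ω) (hτ0 : 0 ≤ τ₀)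
    (hu1 : ∀ y ∈ box z (r + 2), ‖u y‖ = 1) (hω : ∀ y ∈ box z (r + 2), ‖u y - p‖ ≤ ω)
    (hdef : ∀ y ∈ box z (r + 1), ∀ μ (v : V), ‖τ μ y v - v‖ ≤ τ₀ * ‖v‖)
    (hopt : ∀ y ∈ box z (r + 1),
      ‖∑ μ, (τ μ y (u (y + unitVec μ)) + (τ μ (y - unitVec μ)).symm (u (y - unitVec μ)))‖ • u y =
        ∑ μ, (τ μ y (u (y + unitVec μ)) + (τ μ (y - unitVec μ)).symm (u (y - unitVec μ)))) :
    ∑ y ∈ box z ρ, ∑ μ, ‖u (y + unitVec μ) - u y‖ ^ 2 ≤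
      (4 * ((2 : ℝ) ^ d * (1 + 56 * d) ^ d * (8 * ((d : ℝ) + 1)) ^ (d + 1)) * (((ρ : ℝ) + 1) / (r : ℝ)) ^ d +
        (8 * ((2 : ℝ) ^ d * (1 + 56 * d) ^ d * (8 * ((d : ℝ) + 1)) ^ (d + 1)) + 4) * (2 * ω)) *
        ∑ y ∈ box z (r + 1), ∑ μ, ‖u (y + unitVec μ) - u y‖ ^ 2 +
      (4 * ((2 : ℝ) ^ d * (1 + 56 * d) ^ d * (8 * ((d : ℝ) + 1)) ^ (d + 1)) + 2) * (8 * d * ω * τ₀) * ((2 * r + 1 : ℤ) : ℝ) ^ d := by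
  classical
  have hd0 : 0 < d := hd
  set A : ℝ := (2 : ℝ) ^ d * (1 + 56 * d) ^ d * (8 * ((d : ℝ) + 1)) ^ (d + 1) with hA
  have hA0 : 0 ≤ A := by positivity
  set E : Finset (Zd d) → ℝ := fun Q => ∑ y ∈ Q, ∑ μ, ‖u (y + unitVec μ) - u y‖ ^ 2 with hE
  have hE0 : ∀ Q, 0 ≤ E Q := fun Q => Finset.sum_nonneg fun _ _ => Finset.sum_nonneg fun _ _ => sq_nonneg _
  set lam : Zd d → ℝ := fun y => ∑ μ, ((1 - ⟪u y, u (y + unitVec μ)⟫_ℝ) + (1 - ⟪u y, u (y - unitVec μ)⟫_ℝ)) with hlam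
  -- memberships
  have hm2 : ∀ y ∈ box z r, y ∈ box z (r + 2) := fun y hy => box_mono z (by linarith) hy
  have hm2p : ∀ y ∈ box z r, ∀ μ, y + unitVec μ ∈ box z (r + 2) := fun y hy μ => box_mono z (by linarith) (add_unitVec_mem_box hy μ)
  have hm2m : ∀ y ∈ box z r, ∀ μ, y - unitVec μ ∈ box z (r + 2) := fun y hy μ => box_mono z (by linarith) (sub_unitVec_mem_box hy μ)
  have hm1 : ∀ y ∈ box z r, y ∈ box z (r + 1) := fun y hy => box_mono z (by linarith) hy
  -- §a the vector Dirichlet corrector `w` and the harmonic part `h = u − w`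
  obtain ⟨w, hw0, hw⟩ := exists_vec_dirichlet hd0 z r (fun y => ∑ μ, ((u y + u y) - u (y - unitVec μ) - u (y + unitVec μ)))
  set h : Zd d → V := fun y => u y - w y with hh
  have hharm : ∀ y ∈ box z r, ∑ μ, ((h y + h y) - h (y - unitVec μ) - h (y + unitVec μ)) = 0 := by
    intro y hy
    have e : ∑ μ, ((h y + h y) - h (y - unitVec μ) - h (y + unitVec μ)) =
        ∑ μ, ((u y + u y) - u (y - unitVec μ) - u (y + unitVec μ)) - ∑ μ, ((w y + w y) - w (y - unitVec μ) - w (y + unitVec μ)) := by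
      rw [← Finset.sum_sub_distrib]; exact Finset.sum_congr rfl fun μ _ => by simp only [hh]; abel
    rw [e, hw y hy, sub_self]
  -- §b (I1)_τ: `−Δu = λ_τ•u + T′` on `Q_r(z)` with `‖T′‖ ≤ 2dτ₀`, and `0 ≤ λ_τ ≤ λ + 2dτ₀`, `Σλ ≤ E(u;Q_{r+1})`
  set lamT : Zd d → ℝ := fun y => ∑ μ, ((1 - ⟪u y, τ μ y (u (y + unitVec μ))⟫_ℝ) + (1 - ⟪u y, (τ μ (y - unitVec μ)).symm (u (y - unitVec μ))⟫_ℝ)) with hlamT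
  set Tw : Zd d → V := fun y => ∑ μ, ((τ μ y (u (y + unitVec μ)) - u (y + unitVec μ)) + ((τ μ (y - unitVec μ)).symm (u (y - unitVec μ)) - u (y - unitVec μ))) with hTw
  have hm1m : ∀ y ∈ box z r, ∀ μ, y - unitVec μ ∈ box z (r + 1) := fun y hy μ => sub_unitVec_mem_box hy μ
  have hI1 : ∀ y ∈ box z r, ∑ μ, ((u y + u y) - u (y - unitVec μ) - u (y + unitVec μ)) = lamT y • u y + Tw y := by
    intro y hy
    have hn := nbr_sum_sub_eq_twisted τ u y (hu1 y (hm2 y hy)) (hopt y (hm1 y hy))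
    have e : ∑ μ, ((u y + u y) - u (y - unitVec μ) - u (y + unitVec μ)) =
        -∑ μ, ((τ μ y (u (y + unitVec μ)) - u y) + ((τ μ (y - unitVec μ)).symm (u (y - unitVec μ)) - u y)) + Tw y := by
      rw [hTw, ← Finset.sum_neg_distrib, ← Finset.sum_add_distrib]; exact Finset.sum_congr rfl fun μ _ => by abel
    rw [e, hn, neg_smul, neg_neg]
  have hTwn : ∀ y ∈ box z r, ‖Tw y‖ ≤ 2 * d * τ₀ := fun y hy =>
    norm_twistDefectSum_le τ y (fun μ => u (y + unitVec μ)) (fun μ => u (y - unitVec μ)) (fun μ => hu1 _ (hm2p y hy μ)) (fun μ => hu1 _ (hm2m y hy μ))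
      (fun μ v => hdef y (hm1 y hy) μ v) (fun μ v => hdef _ (hm1m y hy μ) μ v)
  have hlamT0 : ∀ y ∈ box z r, 0 ≤ lamT y := fun y hy =>
    Finset.sum_nonneg fun μ _ => add_nonneg (one_sub_inner_nonneg (hu1 y (hm2 y hy)) (by rw [LinearIsometryEquiv.norm_map]; exact hu1 _ (hm2p y hy μ)))
      (one_sub_inner_nonneg (hu1 y (hm2 y hy)) (by rw [LinearIsometryEquiv.norm_map]; exact hu1 _ (hm2m y hy μ)))
  have hlamTle : ∀ y ∈ box z r, lamT y ≤ lam y + 2 * d * τ₀ := by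
    intro y hy
    have hs : ∀ μ, (1 - ⟪u y, τ μ y (u (y + unitVec μ))⟫_ℝ) + (1 - ⟪u y, (τ μ (y - unitVec μ)).symm (u (y - unitVec μ))⟫_ℝ) ≤
        ((1 - ⟪u y, u (y + unitVec μ)⟫_ℝ) + (1 - ⟪u y, u (y - unitVec μ)⟫_ℝ)) + (τ₀ + τ₀) := by
      intro μ
      have h1 := oneSubInner_twist_le (τ μ y) (fun v => hdef y (hm1 y hy) μ v) (hu1 y (hm2 y hy)) (hu1 _ (hm2p y hy μ))
      have h2 := oneSubInner_twist_le (τ μ (y - unitVec μ)).symm (norm_symm_sub_le _ (fun v => hdef _ (hm1m y hy μ) μ v))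
        (hu1 y (hm2 y hy)) (hu1 _ (hm2m y hy μ))
      linarith
    calc lamT y = ∑ μ, ((1 - ⟪u y, τ μ y (u (y + unitVec μ))⟫_ℝ) + (1 - ⟪u y, (τ μ (y - unitVec μ)).symm (u (y - unitVec μ))⟫_ℝ)) := rfl
      _ ≤ ∑ μ, (((1 - ⟪u y, u (y + unitVec μ)⟫_ℝ) + (1 - ⟪u y, u (y - unitVec μ)⟫_ℝ)) + (τ₀ + τ₀)) := Finset.sum_le_sum fun μ _ => hs μ
      _ = lam y + 2 * d * τ₀ := by
          rw [Finset.sum_add_distrib, Finset.sum_const, Finset.card_univ, Fintype.card_fin, nsmul_eq_mul, hlam]; ring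
  have hlamE : ∑ y ∈ box z r, lam y ≤ E (box z (r + 1)) := by
    -- `λ(y) = ½Σ_μ(‖u(y+e)−u y‖² + ‖u(y−e)−u y‖²)`; the backward terms, reindexed, are forward terms at `y − e_μ ∈ Q_{r+1}`
    have hfw : ∑ y ∈ box z r, ∑ μ, (1 - ⟪u y, u (y + unitVec μ)⟫_ℝ) ≤ (1 / 2) * E (box z (r + 1)) := by
      rw [hE]; dsimp only
      rw [Finset.mul_sum]
      calc ∑ y ∈ box z r, ∑ μ, (1 - ⟪u y, u (y + unitVec μ)⟫_ℝ) = ∑ y ∈ box z r, (1 / 2) * ∑ μ, ‖u (y + unitVec μ) - u y‖ ^ 2 := by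
            refine Finset.sum_congr rfl fun y hy => ?_
            rw [Finset.mul_sum]
            refine Finset.sum_congr rfl fun μ _ => ?_
            rw [one_sub_inner_eq (hu1 y (hm2 y hy)) (hu1 _ (hm2p y hy μ)), norm_sub_rev]
        _ ≤ ∑ y ∈ box z (r + 1), (1 / 2) * ∑ μ, ‖u (y + unitVec μ) - u y‖ ^ 2 :=
            Finset.sum_le_sum_of_subset_of_nonneg (box_mono z (by linarith)) fun _ _ _ => by positivity
    have hbw : ∑ y ∈ box z r, ∑ μ, (1 - ⟪u y, u (y - unitVec μ)⟫_ℝ) ≤ (1 / 2) * E (box z (r + 1)) := by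
      have hper : ∀ μ : Fin d, ∑ y ∈ box z r, (1 - ⟪u y, u (y - unitVec μ)⟫_ℝ) ≤ ∑ x ∈ box z (r + 1), (1 / 2) * ‖u (x + unitVec μ) - u x‖ ^ 2 := by
        intro μ
        have e1 : ∑ y ∈ box z r, (1 - ⟪u y, u (y - unitVec μ)⟫_ℝ) = ∑ y ∈ box z r, (1 / 2) * ‖u (y - unitVec μ + unitVec μ) - u (y - unitVec μ)‖ ^ 2 := by
          refine Finset.sum_congr rfl fun y hy => ?_
          rw [sub_add_cancel, one_sub_inner_eq (hu1 y (hm2 y hy)) (hu1 _ (hm2m y hy μ))]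
        have e2 : ∑ y ∈ box z r, (1 / 2) * ‖u (y - unitVec μ + unitVec μ) - u (y - unitVec μ)‖ ^ 2 =
            ∑ x ∈ (box z r).image (fun y => y - unitVec μ), (1 / 2) * ‖u (x + unitVec μ) - u x‖ ^ 2 := by
          rw [Finset.sum_image (fun a _ b _ hab => sub_left_injective hab)]
        have hsub : (box z r).image (fun y => y - unitVec μ) ⊆ box z (r + 1) := by
          intro x hx
          obtain ⟨y, hy, rfl⟩ := Finset.mem_image.1 hx
          exact sub_unitVec_mem_box hy μ
        rw [e1, e2]
        exact Finset.sum_le_sum_of_subset_of_nonneg hsub fun _ _ _ => by positivity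
      calc ∑ y ∈ box z r, ∑ μ, (1 - ⟪u y, u (y - unitVec μ)⟫_ℝ) = ∑ μ, ∑ y ∈ box z r, (1 - ⟪u y, u (y - unitVec μ)⟫_ℝ) := Finset.sum_comm
        _ ≤ ∑ μ, ∑ x ∈ box z (r + 1), (1 / 2) * ‖u (x + unitVec μ) - u x‖ ^ 2 := Finset.sum_le_sum fun μ _ => hper μ
        _ = (1 / 2) * E (box z (r + 1)) := by
            rw [hE]; dsimp only
            rw [Finset.mul_sum, Finset.sum_comm]
            exact Finset.sum_congr rfl fun x _ => by rw [Finset.mul_sum]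
    calc ∑ y ∈ box z r, lam y = ∑ y ∈ box z r, ∑ μ, (1 - ⟪u y, u (y + unitVec μ)⟫_ℝ) + ∑ y ∈ box z r, ∑ μ, (1 - ⟪u y, u (y - unitVec μ)⟫_ℝ) := by
          rw [← Finset.sum_add_distrib]; exact Finset.sum_congr rfl fun y _ => Finset.sum_add_distrib
      _ ≤ (1 / 2) * E (box z (r + 1)) + (1 / 2) * E (box z (r + 1)) := add_le_add hfw hbw
      _ = E (box z (r + 1)) := by ring
  -- §c the maximum principle: `‖h − p‖ ≤ ω` on `Q_{r+1}`, hence `‖w‖ ≤ 2ω` on `Q_r`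
  have hr0 : 0 ≤ r := by linarith
  have hhp : ∀ y ∈ box z (r + 1), ‖h y - p‖ ≤ ω := by
    refine norm_sub_le_of_vecHarmonic hd0 h p z hr0 hharm fun x hx hxn => ?_
    have : h x = u x := by simp only [hh, hw0 x hxn, sub_zero]
    rw [this]; exact hω x (box_mono z (by linarith) hx)
  have hwn : ∀ y ∈ box z r, ‖w y‖ ≤ 2 * ω := by
    intro y hy
    have e : w y = (u y - p) - (h y - p) := by simp only [hh]; abel
    rw [e]
    calc ‖(u y - p) - (h y - p)‖ ≤ ‖u y - p‖ + ‖h y - p‖ := norm_sub_le _ _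
      _ ≤ ω + ω := add_le_add (hω y (hm2 y hy)) (hhp y (hm1 y hy))
      _ = 2 * ω := by ring
  -- §d the corrector energy: `E(w; Q_{r+1}) = Σ_{Q_r} ⟪w, λ_τu + T′⟫ ≤ 2ω·(E(u;Q_{r+1}) + 2dτ₀#Q_r) + 2ω·2dτ₀#Q_r`
  have hcard : ((box z r).card : ℝ) = ((2 * r + 1 : ℤ) : ℝ) ^ d := card_box z (by linarith)
  set S : ℝ := 8 * d * ω * τ₀ * ((2 * r + 1 : ℤ) : ℝ) ^ d with hS
  have hS0 : 0 ≤ S := by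
    have : (0 : ℝ) ≤ ((2 * r + 1 : ℤ) : ℝ) ^ d := by rw [← hcard]; positivity
    rw [hS]; positivity
  have hwE : ∑ y ∈ box z (r + 1), ∑ μ, ‖w (y + unitVec μ) - w y‖ ^ 2 ≤ 2 * ω * E (box z (r + 1)) + S := by
    have hid := vec_energy_identity w z (r + 1) (fun y hy => hw0 y (by simpa using hy))
    rw [← hid]
    have e1 : ∑ y ∈ box z (r + 1), ⟪w y, ∑ μ, ((w y + w y) - w (y - unitVec μ) - w (y + unitVec μ))⟫_ℝ =
        ∑ y ∈ box z r, (lamT y * ⟪w y, u y⟫_ℝ + ⟪w y, Tw y⟫_ℝ) := by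
      rw [← Finset.sum_subset (box_mono z (by linarith : r ≤ r + 1))
        (fun y _ hy => by rw [hw0 y hy, inner_zero_left])]
      refine Finset.sum_congr rfl fun y hy => ?_
      rw [hw y hy, hI1 y hy, inner_add_right, real_inner_smul_right]
    rw [e1]
    have hpt : ∀ y ∈ box z r, lamT y * ⟪w y, u y⟫_ℝ + ⟪w y, Tw y⟫_ℝ ≤ (lam y + 2 * d * τ₀) * (2 * ω) + 2 * ω * (2 * d * τ₀) := by
      intro y hy
      have h1 : ⟪w y, u y⟫_ℝ ≤ 2 * ω := by
        calc ⟪w y, u y⟫_ℝ ≤ ‖w y‖ * ‖u y‖ := real_inner_le_norm _ _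
          _ = ‖w y‖ := by rw [hu1 y (hm2 y hy), mul_one]
          _ ≤ 2 * ω := hwn y hy
      have h2 : ⟪w y, Tw y⟫_ℝ ≤ 2 * ω * (2 * d * τ₀) := by
        calc ⟪w y, Tw y⟫_ℝ ≤ ‖w y‖ * ‖Tw y‖ := real_inner_le_norm _ _
          _ ≤ 2 * ω * (2 * d * τ₀) := mul_le_mul (hwn y hy) (hTwn y hy) (norm_nonneg _) (by positivity)
      have h3 : lamT y * ⟪w y, u y⟫_ℝ ≤ (lam y + 2 * d * τ₀) * (2 * ω) :=
        (mul_le_mul_of_nonneg_left h1 (hlamT0 y hy)).trans (mul_le_mul_of_nonneg_right (hlamTle y hy) (by positivity))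
      linarith
    calc ∑ y ∈ box z r, (lamT y * ⟪w y, u y⟫_ℝ + ⟪w y, Tw y⟫_ℝ)
        ≤ ∑ y ∈ box z r, ((lam y + 2 * d * τ₀) * (2 * ω) + 2 * ω * (2 * d * τ₀)) := Finset.sum_le_sum hpt
      _ = 2 * ω * ∑ y ∈ box z r, lam y + 8 * d * ω * τ₀ * (box z r).card := by
          rw [Finset.sum_add_distrib, Finset.sum_const, nsmul_eq_mul, ← Finset.sum_mul, Finset.sum_add_distrib, Finset.sum_const, nsmul_eq_mul]
          ring
      _ ≤ 2 * ω * E (box z (r + 1)) + S := by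
          rw [hcard, ← hS]
          have h2ω : (0 : ℝ) ≤ 2 * ω := by positivity
          exact add_le_add (mul_le_mul_of_nonneg_left hlamE h2ω) le_rfl
  have hwE' : ∀ Q : Finset (Zd d), ∑ y ∈ Q, ∑ μ, ‖w (y + unitVec μ) - w y‖ ^ 2 ≤ 2 * ω * E (box z (r + 1)) + S := by
    intro Q
    have hsupp := energy_le_of_support (fun _ _ => LinearIsometryEquiv.refl ℝ V) hw0 Q
    simp only [LinearIsometryEquiv.coe_refl, id_eq] at hsupp
    exact hsupp.trans hwE
  -- §e the harmonic part: energy decay from `Q_{r−1}` to `Q_ρ`, and `E(h;Q_{r−1}) ≤ 2E(u;Q_{r+1}) + 2E(w)`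
  have htri : ∀ (Q : Finset (Zd d)) (f g : Zd d → V),
      ∑ y ∈ Q, ∑ μ, ‖(f (y + unitVec μ) + g (y + unitVec μ)) - (f y + g y)‖ ^ 2 ≤
        2 * ∑ y ∈ Q, ∑ μ, ‖f (y + unitVec μ) - f y‖ ^ 2 + 2 * ∑ y ∈ Q, ∑ μ, ‖g (y + unitVec μ) - g y‖ ^ 2 := by
    intro Q f g
    rw [Finset.mul_sum, Finset.mul_sum, ← Finset.sum_add_distrib]
    refine Finset.sum_le_sum fun y _ => ?_
    rw [Finset.mul_sum, Finset.mul_sum, ← Finset.sum_add_distrib]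
    refine Finset.sum_le_sum fun μ _ => ?_
    have e : (f (y + unitVec μ) + g (y + unitVec μ)) - (f y + g y) = (f (y + unitVec μ) - f y) + (g (y + unitVec μ) - g y) := by abel
    rw [e]
    have h1 : ‖(f (y + unitVec μ) - f y) + (g (y + unitVec μ) - g y)‖ ^ 2 ≤ (‖f (y + unitVec μ) - f y‖ + ‖g (y + unitVec μ) - g y‖) ^ 2 :=
      pow_le_pow_left₀ (norm_nonneg _) (norm_add_le _ _) 2
    nlinarith [h1, sq_nonneg (‖f (y + unitVec μ) - f y‖ - ‖g (y + unitVec μ) - g y‖)]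
  have hdec := vec_harmonic_decay (z := z) hρ (by linarith : ρ ≤ r - 1) h (fun y hy => hharm y (by simpa using hy))
  rw [← hA] at hdec
  have er : (((r - 1 : ℤ) : ℝ) + 1) = (r : ℝ) := by push_cast; ring
  rw [er] at hdec
  -- `E(u;Q_ρ) ≤ 2E(h;Q_ρ) + 2E(w;Q_ρ)`
  have hu_ρ : E (box z ρ) ≤ 2 * ∑ y ∈ box z ρ, ∑ μ, ‖h (y + unitVec μ) - h y‖ ^ 2 + 2 * ∑ y ∈ box z ρ, ∑ μ, ‖w (y + unitVec μ) - w y‖ ^ 2 := by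
    have := htri (box z ρ) h w
    have e : ∀ y μ, (h (y + unitVec μ) + w (y + unitVec μ)) - (h y + w y) = u (y + unitVec μ) - u y := fun y μ => by simp only [hh]; abel
    simp only [e] at this
    exact this
  -- `E(h;Q_{r−1}) ≤ 2E(u;Q_{r−1}) + 2E(w;Q_{r−1}) ≤ 2E(u;Q_{r+1}) + 2E(w)`
  have hh_r : ∑ y ∈ box z (r - 1), ∑ μ, ‖h (y + unitVec μ) - h y‖ ^ 2 ≤ 2 * E (box z (r + 1)) + 2 * (2 * ω * E (box z (r + 1)) + S) := by
    have := htri (box z (r - 1)) u (fun y => -w y)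
    have e : ∀ y μ, (u (y + unitVec μ) + -w (y + unitVec μ)) - (u y + -w y) = h (y + unitVec μ) - h y := fun y μ => by simp only [hh]; abel
    have e2 : ∀ y μ, ‖-w (y + unitVec μ) - -w y‖ = ‖w (y + unitVec μ) - w y‖ := fun y μ => by
      rw [← norm_neg]; congr 1; abel
    simp only [e, e2] at this
    have hmono : E (box z (r - 1)) ≤ E (box z (r + 1)) :=
      Finset.sum_le_sum_of_subset_of_nonneg (box_mono z (by linarith)) fun _ _ _ => Finset.sum_nonneg fun _ _ => sq_nonneg _
    have hwr := hwE' (box z (r - 1))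
    calc ∑ y ∈ box z (r - 1), ∑ μ, ‖h (y + unitVec μ) - h y‖ ^ 2
        ≤ 2 * E (box z (r - 1)) + 2 * ∑ y ∈ box z (r - 1), ∑ μ, ‖w (y + unitVec μ) - w y‖ ^ 2 := this
      _ ≤ 2 * E (box z (r + 1)) + 2 * (2 * ω * E (box z (r + 1)) + S) := by linarith
  -- assemble
  have hrR : (0 : ℝ) < r := by exact_mod_cast (show (0 : ℤ) < r by linarith)
  have hρR0 : (0 : ℝ) ≤ ρ := by exact_mod_cast hρ
  have hq0 : 0 ≤ (((ρ : ℝ) + 1) / (r : ℝ)) ^ d := by positivity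
  have hAq : 0 ≤ A * (((ρ : ℝ) + 1) / (r : ℝ)) ^ d := mul_nonneg hA0 hq0
  have hwρ := hwE' (box z ρ)
  have hEr := hE0 (box z (r + 1))
  have hρr' : (ρ : ℝ) + 1 ≤ r := by exact_mod_cast hρr
  have hq1 : (((ρ : ℝ) + 1) / (r : ℝ)) ^ d ≤ 1 := pow_le_one₀ (by positivity) (by rw [div_le_one hrR]; exact hρr')
  have hAq1 : A * (((ρ : ℝ) + 1) / (r : ℝ)) ^ d ≤ A := mul_le_of_le_one_right hA0 hq1
  calc E (box z ρ) ≤ 2 * ∑ y ∈ box z ρ, ∑ μ, ‖h (y + unitVec μ) - h y‖ ^ 2 + 2 * ∑ y ∈ box z ρ, ∑ μ, ‖w (y + unitVec μ) - w y‖ ^ 2 := hu_ρ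
    _ ≤ 2 * (A * (((ρ : ℝ) + 1) / (r : ℝ)) ^ d * (2 * E (box z (r + 1)) + 2 * (2 * ω * E (box z (r + 1)) + S))) + 2 * (2 * ω * E (box z (r + 1)) + S) := by
        have t1 := hdec.trans (mul_le_mul_of_nonneg_left hh_r hAq)
        linarith
    _ = (4 * A * (((ρ : ℝ) + 1) / (r : ℝ)) ^ d + (8 * (A * (((ρ : ℝ) + 1) / (r : ℝ)) ^ d) + 4) * ω) * E (box z (r + 1)) +
          (4 * (A * (((ρ : ℝ) + 1) / (r : ℝ)) ^ d) + 2) * S := by ring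
    _ ≤ (4 * A * (((ρ : ℝ) + 1) / (r : ℝ)) ^ d + (8 * A + 4) * (2 * ω)) * E (box z (r + 1)) + (4 * A + 2) * S := by
        have h84 : 0 ≤ (8 * A + 4) * ω := by positivity
        have t1 : (4 * A * (((ρ : ℝ) + 1) / (r : ℝ)) ^ d + (8 * (A * (((ρ : ℝ) + 1) / (r : ℝ)) ^ d) + 4) * ω) * E (box z (r + 1)) ≤
            (4 * A * (((ρ : ℝ) + 1) / (r : ℝ)) ^ d + (8 * A + 4) * (2 * ω)) * E (box z (r + 1)) := by
          apply mul_le_mul_of_nonneg_right _ hEr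
          nlinarith [hAq1, hω0, h84, hAq]
        have t2 : (4 * (A * (((ρ : ℝ) + 1) / (r : ℝ)) ^ d) + 2) * S ≤ (4 * A + 2) * S := by
          apply mul_le_mul_of_nonneg_right _ hS0
          linarith
        linarith
    _ = _ := by rw [hS, hA]; ring

end Summit.QuantumFields.YangMills.Theorems.PoincareLipschitzSphereMapSmallRangeEnergyDecayTwisted

end
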